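import Mathlib
import Literature.Computability.Complexity.DeterminantFP
import Literature.Algebra.EuclideanLattices.IntegerMatrixInverseGS
import Literature.Algebra.EuclideanLattices.BabaiListProgram
import Literature.Algebra.EuclideanLattices.SimultaneousApproximationLLLProofs
import Literature.Computability.Complexity.AOWListMatrix
import HarnessLib

/-!
# Lenstra's algorithm in fixed dimension, VII: the decision procedure as a list program

Topic `Computability/Complexity`, grouping namespace `FixedDimILP`. The DECISION PROCEDURE for integer
feasibility of `{x ∈ ℤ^N | a · x ≤ β, (a, β) ∈ rows}` over bounded polyhedra, for each fixed `N`, as an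
explicit functional program on lists of integers — the object whose polynomial running time
(`FixedDimILPMachine*.lean`) and correctness (`FixedDimILPDecider*.lean`) together discharge Lagarias's
fixed-dimension theorem. It is Lenstra's algorithm (Lenstra 1983, §1–§2; Schrijver 1986, §18.4) with the
sub-algorithms the tree already runs in polynomial time plugged in: Cohen's integral Gram–Schmidt
quasi-inverse `GSInverse.invCols/invDen` (exact solutions of square systems, `T⁻¹ = invMatrix T / det²`), the
tree's LLL machine (`SimApproxLLL.lllOut`, LLL82 Prop. 1.26) and Babai's nearest plane on integers
(`Babai.coeffsL`), and with every step that print does by linear programming done by BRUTE FORCE over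
`N`-subsets, which is polynomial for fixed `N`:

1. `thickenL` — `(a, β) ↦ (2a, 2β + 1)` (same integer points; full-dimensional around each of them);
2. `verticesL N` — all basic feasible solutions `p/d` of the thickened system (every `N`-tuple of rows,
   `detZ ≠ 0`, solved exactly by `invCols/invDen`, kept if feasible);
3. `goodTuples N V` — the `(N+1)`-tuples of vertices with `det W̃ ≠ 0` whose barycentric coordinates of all
   of `V` lie in `[-1, 1]` (an exact integer test, `baryTest`); a maximal-volume tuple is one (file II);
4. `latRows`, `shiftL`, `targetL` — the lattice `B₀ = (N+1) D • G` (`W̃ G = Δ₂ • 1`) and the centre `t`;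
5. `lllRowsL` — the reduced basis `B₁` (rows of `lllOut`), `transU` — `U = B₁ G₀ / det(B₀)²`, `U'` likewise;
6. `babaiPoint` — `x_B = z U` with `z = coeffsL B₁ t`; accept if `x_B` satisfies the ORIGINAL rows (`satL`);
7. otherwise recurse: for every anchor vertex `v` and `j < slices N = 2^{N+1}(N+1)³ + 1`, the section
   (`sectionRowsL`, file IV) at level `κ = ⌈c · v⌉ + j`, `c` the last column of `U'`, decided in dimension
   `N - 1`; dimension `0`: all right-hand sides nonnegative. `decideL N rows`.

This file is DEFINITIONS ONLY (plus unfolding lemmas); no claim is made here.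

## References

* H. W. Lenstra, Jr., *Integer programming with a fixed number of variables*, Math. Oper. Res. 8 (1983)
  538–548, §1 (the algorithm), §2 (the simplex; remark (b) p. 545 for fixed `n`), §1 p. 541 (recursion).
  [LenstraHW1983]
* A. Schrijver, *Theory of Linear and Integer Programming*, Wiley 1986, §18.4, Cor. 18.7a. [Schrijver1986]
* L. Babai, Combinatorica 6 (1986), §3. [Babai1986]
* H. Cohen, *A Course in Computational Algebraic Number Theory*, GTM 138, §2.6.3. [Cohen1993]
-/

namespace Literature.Computability.Complexity

namespace FixedDimILP

open Literature.Algebra.EuclideanLattices Literature.Algebra.EuclideanLattices.GSInverse IntDetFP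

/-! ### Rows, vertices, satisfaction -/

/-- A row `(a, β)` as lists: coefficient list and right-hand side. [folklore] -/
abbrev LRow : Type := List ℤ × ℤ

/-- A rational point `p / d`: integer numerator list and natural denominator. [folklore] -/
abbrev LVert : Type := List ℤ × ℕ

/-- Exact satisfaction of all rows by an integer point: `a · x ≤ β`. [folklore] -/
def satL (rows : List LRow) (x : List ℤ) : Bool := rows.all fun r => decide (dotZ r.1 x ≤ r.2)

/-- Satisfaction of all rows by a rational point `p / d` (`d > 0`): `a · p ≤ β d`. [folklore] -/
def satV (rows : List LRow) (v : LVert) : Bool := rows.all fun r => decide (dotZ r.1 v.1 ≤ r.2 * v.2)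

/-- Step 1, the THICKENED system `(2a, 2β + 1)`: the same integer points, and a box around each of them.
[cite: LenstraHW1983, §1 (transforming the problem)] -/
def thickenL (rows : List LRow) : List LRow := rows.map fun r => (r.1.map (2 * ·), 2 * r.2 + 1)

/-! ### Brute force over tuples -/

/-- All `k`-tuples (lists of length `k`) of elements of `l`, with repetition. [folklore] -/
def tuplesL {α : Type} : ℕ → List α → List (List α)
  | 0, _ => [[]]
  | k + 1, l => (l.map fun a => (tuplesL k l).map (a :: ·)).flatten

/-- Step 2a: the coefficient matrix of a tuple of rows. [folklore] -/
def coefMat (S : List LRow) : List (List ℤ) := S.map Prod.fst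

/-- Step 2b: the numerator of the solution of the square system of a tuple `S`: `G b` with
`G = invMatrix (coefMat S)` (`A G = det² • 1`), i.e. `(G b)ₜ = Σₖ Gₜₖ bₖ`, `Gₜₖ = (invCols k)ₜ`.
[cite: Cohen1993, §2.6.3] -/
def solveNum (S : List LRow) : List ℤ :=
  (List.range S.length).map fun t => dotZ ((invCols (coefMat S)).map fun col => col.getD t 0) (S.map Prod.snd)

/-- Step 2c: the basic solution of a tuple as a rational point `(G b, det²)`. [cite: Schrijver1986, §8.5 (basic solutions)] -/
def vertexOf (S : List LRow) : LVert := (solveNum S, (invDen (coefMat S)).toNat)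

/-- Step 2: **the VERTEX LIST** — basic FEASIBLE solutions of `rows'` over all `N`-tuples of its rows.
[cite: LenstraHW1983, §2 remark (b) (brute force for fixed `n`)] [cite: Schrijver1986, Thm. 8.4] -/
def verticesL (N : ℕ) (rows' : List LRow) : List LVert :=
  ((tuplesL N rows').filter fun S => decide (detZ (coefMat S) ≠ 0) && satV rows' (vertexOf S)).map vertexOf

/-! ### The simplex of maximal volume, in integers -/

/-- The common denominator `D = Π dᵢ` of a tuple of vertices. [folklore] -/
def denomProd (cand : List LVert) : ℕ := (cand.map Prod.snd).prod

/-- The `i`-th vertex of a tuple (junk `([], 0)` past the end). [folklore] -/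
def vertAt (cand : List LVert) (i : ℕ) : LVert := cand.getD i ([], 0)

/-- The integer numerator `Pᵢ = (D / dᵢ) pᵢ` of the `i`-th vertex over the common denominator. [folklore] -/
def numer (cand : List LVert) (i : ℕ) : List ℤ :=
  (vertAt cand i).1.map fun z => ((denomProd cand / (vertAt cand i).2 : ℕ) : ℤ) * z

/-- The integer EDGE MATRIX `W̃`: rows `Pᵢ₊₁ - P₀`, `i < N`. [cite: LenstraHW1983, §2] -/
def edgeRows (N : ℕ) (cand : List LVert) : List (List ℤ) :=
  (List.range N).map fun i => (List.range N).map fun j => (numer cand (i + 1)).getD j 0 - (numer cand 0).getD j 0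

/-- `Δ₂ = det(W̃)²` (`invDen`). [cite: Cohen1993, §2.6.3] -/
def delta2 (N : ℕ) (cand : List LVert) : ℤ := invDen (edgeRows N cand)

/-- The rows of `G = invMatrix W̃` (the transposed `invCols`): `Gₜₖ = (invCols k)ₜ`. [cite: Cohen1993, §2.6.3] -/
def gRows (N : ℕ) (cand : List LVert) : List (List ℤ) :=
  (List.range N).map fun t => (invCols (edgeRows N cand)).map fun col => col.getD t 0

/-- The integer barycentric numerators of a vertex `v = p/d` with respect to a tuple:
`q = (D p - d P₀) G`, i.e. `qₖ = (D p - d P₀) · (invCols k)` (so `τ(v) = q / (Δ₂ d)`). [cite: LenstraHW1983, §2] -/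
def baryNum (N : ℕ) (cand : List LVert) (v : LVert) : List ℤ :=
  (invCols (edgeRows N cand)).map fun col =>
    dotZ ((List.range N).map fun j => (denomProd cand : ℤ) * v.1.getD j 0 - (v.2 : ℤ) * (numer cand 0).getD j 0) col

/-- The exact test "all barycentric coordinates of `v` lie in `[-1, 1]`": `|qₖ| ≤ Δ₂ d` for all `k` and
`|Δ₂ d - Σ qₖ| ≤ Δ₂ d` (the coordinate of `p₀` is `1 - Σ τₖ`). [cite: LenstraHW1983, §2 (maximal simplex)] -/
def baryTest (N : ℕ) (cand : List LVert) (v : LVert) : Bool :=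
  ((baryNum N cand v).all fun q => decide (|q| ≤ delta2 N cand * v.2)) &&
    decide (|delta2 N cand * v.2 - (baryNum N cand v).sum| ≤ delta2 N cand * v.2)

/-- A GOOD tuple: nonsingular edge matrix and all of `V` inside the doubled simplex. [cite: LenstraHW1983, §2] -/
def goodTuple (N : ℕ) (V : List LVert) (cand : List LVert) : Bool :=
  decide (detZ (edgeRows N cand) ≠ 0) && V.all (baryTest N cand)

/-- Step 3: the good `(N+1)`-tuples of vertices (the first one is used). [cite: LenstraHW1983, §2] -/
def goodTuples (N : ℕ) (V : List LVert) : List (List LVert) := (tuplesL (N + 1) V).filter (goodTuple N V)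

/-! ### The lattice and the centre -/

/-- Step 4a: the lattice basis `B₀ = (N+1) D • G` (rows). [cite: LenstraHW1983, §1 (the lattice `τℤⁿ`)] -/
def latRows (N : ℕ) (cand : List LVert) : List (List ℤ) :=
  (gRows N cand).map fun row => row.map fun z => (((N : ℤ) + 1) * (denomProd cand : ℤ)) * z

/-- Step 4b: the shift `s = (N+1) (P₀ G)`: `sₖ = (N+1) P₀ · (invCols k)`. [folklore] -/
def shiftL (N : ℕ) (cand : List LVert) : List ℤ :=
  (invCols (edgeRows N cand)).map fun col => ((N : ℤ) + 1) * dotZ (numer cand 0) col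

/-- Step 4c: the centre `t = Δ₂ 𝟙 + s`. [cite: LenstraHW1983, §1 (the point `p`)] -/
def targetL (N : ℕ) (cand : List LVert) : List ℤ := (shiftL N cand).map fun s => delta2 N cand + s

/-! ### LLL, the transition matrices, Babai -/

/-- Step 5a: **the reduced basis** — the rows of the output of the tree's LLL machine on `⟨N, B₀⟩`
(`SimApproxLLL.lllOut`, the function `lllMachineF` computes on codes), read off its row-major entry list.
[cite: LenstraLenstraLovasz1982, Prop. 1.26] -/
noncomputable def lllRowsL (N : ℕ) (B : List (List ℤ)) : List (List ℤ) :=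
  (List.range N).map fun i => ((SimApproxLLL.flatOf (SimApproxLLL.lllOut ⟨N, LMat.toMat N N B⟩)).drop (i * N)).take N

/-- Step 5b: **the transition matrix** `U` with `B₁ = U B₀`: `Uᵢⱼ = (B₁)ᵢ · (invCols B₀)ⱼ / invDen B₀`, an
exact division (file V). [cite: Schrijver1986, Cor. 4.3b] -/
def transU (B₁ B₀ : List (List ℤ)) : List (List ℤ) :=
  B₁.map fun row => (invCols B₀).map fun col => dotZ row col / invDen B₀

/-- Column `j` of a list matrix. [folklore] -/
def colOf (U : List (List ℤ)) (j : ℕ) : List ℤ := U.map fun row => row.getD j 0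

/-- Step 6: **Babai's point** `x_B = z U`, `z = coeffsL B₁ t` (nearest plane in the reduced basis, pulled
back to `ℤ^N`). [cite: Babai1986, §3] [cite: LenstraHW1983, §1 (first case)] -/
noncomputable def babaiPoint (N : ℕ) (B₁ U : List (List ℤ)) (t : List ℤ) : List ℤ :=
  (List.range N).map fun j => dotZ (Babai.coeffsL B₁ t) (colOf U j)

/-! ### The recursion -/

/-- `⌈a / d⌉` for `d > 0`, with integers only. [folklore] -/
def ceilDiv (a d : ℤ) : ℤ := -((-a) / d)

/-- Step 7a: the sectioned rows at level `κ` (file IV, on lists): coefficients `a · Uⱼ` (`j < N - 1`),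
right-hand side `β - κ (a · U_{N-1})`. [cite: Schrijver1986, Cor. 18.7a (65)] -/
def sectionRowsL (N : ℕ) (rows : List LRow) (U : List (List ℤ)) (κ : ℤ) : List LRow :=
  rows.map fun r => ((U.take (N - 1)).map fun u => dotZ r.1 u, r.2 - κ * dotZ r.1 (U.getD (N - 1) []))

/-- The number of hyperplanes tried per anchor: `2^{N+1} (N+1)³ + 1` (file III with `R₀/ρ₀ = 2(N+1)³`).
[cite: LenstraHW1983, §1 (the number of values of `k`)] [cite: Schrijver1986, Thm. 18.7 (46)] -/
def slices (N : ℕ) : ℕ := 2 ^ (N + 1) * (N + 1) ^ 3 + 1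

/-- The levels tried for an anchor vertex `v = p/d`: `⌈c · v⌉ + j`, `j < slices N`. [cite: LenstraHW1983, §1] -/
def levelsOfAnchor (N : ℕ) (c : List ℤ) (v : LVert) : List ℤ :=
  (List.range (slices N)).map fun j => ceilDiv (dotZ c v.1) v.2 + j

/-- **LENSTRA'S ALGORITHM for bounded polyhedra in fixed dimension, as a list program**:
`decideL N rows` (see the module docstring for the seven steps). [cite: LenstraHW1983, §1–§2] [cite: Schrijver1986, Cor. 18.7a] -/
noncomputable def decideL : ℕ → List LRow → Bool
  | 0, rows => rows.all fun r => decide (0 ≤ r.2)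
  | N' + 1, rows =>
    let V := verticesL (N' + 1) (thickenL rows)
    let good := goodTuples (N' + 1) V
    if good.isEmpty then false else
      let cand := good.headD []
      let B₀ := latRows (N' + 1) cand
      let B₁ := lllRowsL (N' + 1) B₀
      let U := transU B₁ B₀
      let c := colOf (transU B₀ B₁) N'
      satL rows (babaiPoint (N' + 1) B₁ U (targetL (N' + 1) cand)) ||
        V.any fun v => (levelsOfAnchor (N' + 1) c v).any fun κ => decideL N' (sectionRowsL (N' + 1) rows U κ)

/-- Unfolding of the base case. [folklore] -/
theorem decideL_zero (rows : List LRow) : decideL 0 rows = rows.all fun r => decide (0 ≤ r.2) := rfl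

/-- Unfolding of the recursive case. [folklore] -/
theorem decideL_succ (N' : ℕ) (rows : List LRow) : decideL (N' + 1) rows =
    (let V := verticesL (N' + 1) (thickenL rows)
     let good := goodTuples (N' + 1) V
     if good.isEmpty then false else
      let cand := good.headD []
      let B₀ := latRows (N' + 1) cand
      let B₁ := lllRowsL (N' + 1) B₀
      let U := transU B₁ B₀
      let c := colOf (transU B₀ B₁) N'
      satL rows (babaiPoint (N' + 1) B₁ U (targetL (N' + 1) cand)) ||
        V.any fun v => (levelsOfAnchor (N' + 1) c v).any fun κ => decideL N' (sectionRowsL (N' + 1) rows U κ)) := rfl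

/-- **The decider on instances of the tree's `ILPInstance` shape, read as lists**: the dimension must be
the fixed `n`, the rows are listed. [cite: LenstraHW1983, §1] -/
noncomputable def decideInstL (n : ℕ) (P : ℕ × List LRow) : Bool := decide (P.1 = n) && decideL n P.2

end FixedDimILP

end Literature.Computability.Complexity
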